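import Summits.QuantumFields.BalabanUV.Beta.CombChartStepJets
import Summits.QuantumFields.BalabanUV.Beta.CombChartSpreadBlind
import Summits.QuantumFields.BalabanUV.Beta.E3ContactFactor
import Summits.QuantumFields.BalabanUV.Beta.SymShiftGaugeBlind
import Summits.QuantumFields.BalabanUV.Beta.SymResolventPseudoInverse

/-!
# `BalabanUV.Beta.CombChartContactFactor` — binder row D1, RULING R-D1-g35-1 (chart (III′)), brick P4b-i: **THE BLOCK FACTS OF THE CHART-(III′) PAIR
# `(G′_j, 𝕄′_j) = (GcombSh Lc j, bhKStepSh d Lc (Dsh Lc) j)` AND THE CUBIC-SECTOR CONTACT LAW THROUGH `G′_j`** — the (III′) twin of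
# `RelInvFactorSandwich` §4 + `E3ContactFactor` §4 (`Gsym ↦ GcombSh`), at an1's TYPED shift `Dsh Lc` (the blindness letters K1 of leaf-03's
# `CombChartSpreadBlind` are for that shift), every shift letter a THEOREM ((Dff)(Dmm) `rfl`, (DG) by `SymShiftGaugeBlind` as in `DshAn1End`, (Dnull) `DshAn1`)

HONEST FRAMING (cell contract, verbatim): «discharging `BetaPertH` makes Bałaban's UV stability UNCONDITIONAL — a real constructive-QFT
result; it is NOT the continuum limit and NOT the Clay problem.»  HONEST DEPENDENCY: continuum YM on T⁴ ⇐ BetaPertH ∧ nine spine estimates (0/9 proved);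
BetaPertH ⇐ (D1) ∧ (D4) ∧ CAP+tail; G-an2-4 gates asym, D1 and NE2/3/4.
DERIVED cell leaf ([folklore] kernel bookkeeping BY NAME; β sub-cell, BINDER-OWNERS row D1 OWNER `b2b-balaban-beta-an2` gen 36).  No statement of Bałaban's papers,
no `[cite:]`, no `Prop` fact, no `def`.  WHY: the (Sr-conj) letter of the chart-(III′) literal `JsB12CombSh⁰` (slot recursion through `G′_j`) is the chart-(II) induction
`ReflectionLocusSymShift.hSrC_SrecOf_Gsym_all` re-run at `G := GcombSh`; its step is the chart-free headline `E3ContactFactor.e3OfK_bref_inl_inl_of_lawM`, whose eight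
block facts about `(K, 𝕄)` this file supplies for `(G′_j, 𝕄′_j)`.  MECHANISM: `G′_j = trK (piK ρ_c) ∘ G_j ∘ piK ρ_c` (`coDressKAt`), the rooted comb kernel `piK ρ_c` is the
identity on multiplier legs with zero mixed blocks (`comp_piK_inr`, `trK_piK_comp_inr`) and the legged border is BLIND to it (leaf-03 g19's `comp_piK_bhKStepSh` ∕
`comp_bhKStepSh_trK_piK`), so every multiplier-leg block fact of `(G_j, 𝕄′_j)` (chart (II), `RelInvFactorSandwich` §4) transfers verbatim.
WHAT: §1 (DG) for an1's shift, discharged (`comp_Gsym_Dsh_inr_inl` here — the `have`s of `DshAn1End` as lemmas, generic `d`; its twin `comp_Dsh_Gsym_inl_inr` is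
`SymResolventPseudoInverse`'s, imported); §2 `G′_j`'s multiplier
structure (`spr_GcombSh`, `GcombSh_inr_row∕col_coarse`, `GcombSh_inr_inr`, `mmRead_GcombSh = E2 (j+1)`); §3 the products with the legged border
(`comp_bhKStepSh_GcombSh`, `comp_GcombSh_bhKStepSh`) and the four block facts (`…_inl_inr = 0`, `…_inr_inl = 0`, `…_inr_inr = 1_coarse`); §4 the contact law
**`e3OfK_GcombSh_bref_inl_inl_of_law`** (and the primed form `…_of_law'` against `bhKStepSh d Lc (Dsh Lc) (j+1)`).  Discharges NO binder of the row by itself;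
NOT D1, NOT `BetaPertH`, NOT continuum, NOT Clay.
Provenance: β sub-cell, unit beta-an2 gen 36, 2026-08-22 (v1); over `CombChartStepJets` (P3), `CombChartResolventRules` (P1), leaf-03 g19's `CombChartSpreadBlind` (K1),
`RelInvFactorSandwich`, `E3ContactFactor`, `SymShiftGaugeBlind`, `SymResolventPseudoInverse`, `DshAn1(Spread)` BY NAME; no existing file touched.
-/

noncomputable section

open Finset
open scoped BigOperators
open Literature.Probability.LatticeModels (Torus.proj)
open Literature.MathematicalPhysics.QuantumFieldTheory
open Literature.MathematicalPhysics.QuantumFieldTheory.Balaban1983to89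
open Literature.MathematicalPhysics.QuantumFieldTheory.Balaban1983to89.Beta
open ExpKernelCalculus (MKer Decays comp)
open PolarizationSign (reflSign)
open KernelReflection (refK)
open ResolventReflection (bref Φ)
open AffineAveraging (unitVec)
open AveragingContours (blk)
open LatticeForm (quo)
open OneStepResolventKernel (Fib LocStencil proj_zsmul quo_zsmul eq_zsmul_quo_of_proj)
open OneStepKernelFamily (KInvStep)
open BalabanStepJetsSucc (mmRead mmRead_inl_inl E2 wVH)
open AveragingContoursRooted (ctr ctrOff ctrOff_mem_box)
open Summit.QuantumFields.BalabanUV.Beta.TameKernelCalculus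
open Summit.QuantumFields.BalabanUV.Beta.ChartConjugation (conjV)
open Summit.QuantumFields.BalabanUV.Beta.AxialDressingRooted (one_le_of_neZero piK coDressKAt coDressKAt_eq comp_piK_inr trK_piK_comp_inr spr_piK spr_trK_piK)
open Summit.QuantumFields.BalabanUV.Beta.BorderedHessian (bhK spr_bhK bhKStep bhKStep_succ_inl_inl stepScale stepScale_ne_zero diagK)
open Summit.QuantumFields.BalabanUV.Beta.SymSliceProjectorKernel (symEc)
open Summit.QuantumFields.BalabanUV.Beta.SpineRooted (e3OfK)
open Summit.QuantumFields.BalabanUV.Beta.E3CoDressedContact (conjV_diagK_inl_inl_of_ff)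
open Summit.QuantumFields.BalabanUV.Beta.E3ContactGenerator (ctGenM)
open Summit.QuantumFields.BalabanUV.Beta.SymmetrisedStepJets (Gsym)
open Summit.QuantumFields.BalabanUV.Beta.SymShiftedSpread (bhKStepSh bhKStepSh_apply spr_bhKStepSh mmRead_Gsym)
open Summit.QuantumFields.BalabanUV.Beta.RelInvNullShift (spr_add)
open Summit.QuantumFields.BalabanUV.Beta.RelInvFactorSandwich (comp_apply' comp_row_eq_zero comp_col_eq_zero spr_Gsym Gsym_inr_row_coarse Gsym_inr_col_coarse
  comp_bhKStepSh_Gsym_inl_inr comp_Gsym_bhKStepSh_inr_inl comp_bhKStepSh_Gsym_inr_inr comp_Gsym_bhKStepSh_inr_inr)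
open Summit.QuantumFields.BalabanUV.Beta.E3ContactFactor (e3OfK_bref_inl_inl_of_lawM bhKStepSh_mf bhKStepSh_mm)
open Summit.QuantumFields.BalabanUV.Beta.ChartConjugationRelative (spr_comp)
open Summit.QuantumFields.BalabanUV.Beta.DshAn1 (Dsh Dsh_inl_inl Dsh_inr_inr Dsh_inr_inl_eq_neg Dsh_inl_inr_eq_sub lam04 lam04_eq_zero_of_ne_blk spr_Dsh
  comp_comp_symEc_Dsh_symEc)
open Summit.QuantumFields.BalabanUV.Beta.SymShiftGaugeBlind (comp_Gsym_Dsh_inr_inl_of_grad)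
open Summit.QuantumFields.BalabanUV.Beta.SymResolventPseudoInverse (comp_Dsh_Gsym_inl_inr)
open Summit.QuantumFields.BalabanUV.Beta.CombChartSpreadBlind (comp_bhKStepSh_trK_piK comp_piK_bhKStepSh)
open Summit.QuantumFields.BalabanUV.Beta.CombChartResolventRules (spr_coDressKAt_Gsym refK_coDressKAt_Gsym)
open Summit.QuantumFields.BalabanUV.Beta.CombChartStepJets (GcombSh GcombSh_apply)
open Summit.QuantumFields.BalabanUV.Beta.WardLocusInduction (wVH_eq_stepScale_sq)

namespace Summit.QuantumFields.BalabanUV.Beta.CombChartContactFactor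

variable {d : ℕ} {Lc : ℕ} [NeZero Lc]

/-! ## §1 (DG) for an1's typed shift `Dsh Lc`, discharged (generic `d`; the `have`s of `DshAn1End` as lemmas) -/

/-- [folklore] (Dgrad) the multiplier–field leg of an1's shift is a coarse gradient of a finitely supported potential. -/
theorem Dsh_grad (z : Fin (d + 1) → ℤ) (b : Fin (d + 1)) :
    ∃ φ : (Fin (d + 1) → ℤ) → ℝ, (Function.support φ).Finite ∧
      ∀ (x : Fin (d + 1) → ℤ) (μ : Fin (d + 1)), Torus.proj Lc x = 0 → Dsh Lc x z (Sum.inr μ) (Sum.inl b) = φ (quo Lc x + unitVec μ) - φ (quo Lc x) := by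
  have hLc1 : 1 ≤ Lc := one_le_of_neZero Lc
  refine ⟨fun Y => -lam04 Lc b z Y, (Set.finite_singleton (blk Lc z)).subset (fun Y hY => ?_), fun x m hx => ?_⟩
  · by_contra hne
    apply hY
    show -lam04 Lc b z Y = 0
    rw [lam04_eq_zero_of_ne_blk hLc1 (fun h => hne (Set.mem_singleton_iff.mpr h)), neg_zero]
  · rw [Dsh_inr_inl_eq_neg, Dsh_inl_inr_eq_sub, if_pos hx]; ring

/-- [folklore] **(DG), first half, for an1's shift: `(G_j ∘ Dsh Lc)_mf = 0`.** -/
theorem comp_Gsym_Dsh_inr_inl (j : ℕ) (x z : Fin (d + 1) → ℤ) (m b : Fin (d + 1)) :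
    comp (Gsym (d := d) Lc j) (Dsh Lc) x z (Sum.inr m) (Sum.inl b) = 0 :=
  comp_Gsym_Dsh_inr_inl_of_grad (fun x z β β' => Dsh_inl_inl Lc x z β β') Dsh_grad j x z m b

/-! ## §2 The multiplier structure of `G′_j = GcombSh Lc j = trK (piK ρ_c) ∘ G_j ∘ piK ρ_c` -/

/-- [folklore] `G′_j` is spread. -/
theorem spr_GcombSh (j : ℕ) : Spr (GcombSh (d := d) Lc j) := spr_coDressKAt_Gsym Lc j

/-- [folklore] `G′_j` unfolded as a double product. -/
theorem GcombSh_eq_comp (j : ℕ) :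
    GcombSh (d := d) Lc j = comp (comp (trK (piK (ctr (d + 1) Lc) Lc)) (Gsym Lc j)) (piK (ctr (d + 1) Lc) Lc) := by
  rw [GcombSh_apply, coDressKAt_eq]

/-- [folklore] The multiplier rows of `trK (piK ρ_c) ∘ G_j` are those of `G_j`. -/
theorem comp_trK_piK_Gsym_inr (j : ℕ) (x y : Fin (d + 1) → ℤ) (m : Fin (d + 1)) (f : Fib d) :
    comp (trK (piK (ctr (d + 1) Lc) Lc)) (Gsym (d := d) Lc j) x y (Sum.inr m) f = Gsym Lc j x y (Sum.inr m) f :=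
  trK_piK_comp_inr _ _ _ _ _ _ _

/-- [folklore] `G′_j` has coarse multiplier rows. -/
theorem GcombSh_inr_row_coarse (j : ℕ) (x z : Fin (d + 1) → ℤ) (m : Fin (d + 1)) (b : Fib d) (hx : Torus.proj Lc x ≠ 0) :
    GcombSh (d := d) Lc j x z (Sum.inr m) b = 0 := by
  rw [GcombSh_eq_comp]
  exact comp_row_eq_zero (fun y f => by rw [comp_trK_piK_Gsym_inr, Gsym_inr_row_coarse j x y m f hx]) z b

/-- [folklore] The multiplier columns of `trK (piK ρ_c) ∘ G_j` vanish off the coarse sites. -/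
theorem comp_trK_piK_Gsym_inr_col_coarse (j : ℕ) (x z : Fin (d + 1) → ℤ) (a : Fib d) (m : Fin (d + 1)) (hz : Torus.proj Lc z ≠ 0) :
    comp (trK (piK (ctr (d + 1) Lc) Lc)) (Gsym (d := d) Lc j) x z a (Sum.inr m) = 0 :=
  comp_col_eq_zero (fun y f => Gsym_inr_col_coarse j y z f m hz) x a

/-- [folklore] `G′_j` has coarse multiplier columns. -/
theorem GcombSh_inr_col_coarse (j : ℕ) (x z : Fin (d + 1) → ℤ) (a : Fib d) (m : Fin (d + 1)) (hz : Torus.proj Lc z ≠ 0) :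
    GcombSh (d := d) Lc j x z a (Sum.inr m) = 0 := by
  rw [GcombSh_eq_comp, comp_piK_inr, comp_trK_piK_Gsym_inr_col_coarse j x z a m hz]

/-- [folklore] **THE MULTIPLIER BLOCK OF `G′_j` IS THAT OF `G_j`** (the comb dressing touches field legs only). -/
theorem GcombSh_inr_inr (j : ℕ) (x z : Fin (d + 1) → ℤ) (m m' : Fin (d + 1)) :
    GcombSh (d := d) Lc j x z (Sum.inr m) (Sum.inr m') = Gsym Lc j x z (Sum.inr m) (Sum.inr m') := by
  rw [GcombSh_eq_comp, comp_piK_inr, comp_trK_piK_Gsym_inr]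

/-- [folklore] **`mmRead Lc G′_j = E2 (j+1)`** (`= mmRead Lc G_j`, `SymShiftedSpread.mmRead_Gsym`). -/
theorem mmRead_GcombSh (j : ℕ) : mmRead Lc (GcombSh (d := d) Lc j) = E2 d Lc (j + 1) := by
  rw [← mmRead_Gsym (d := d) (Lc := Lc) j]
  funext x z a b
  rcases a with α | m <;> rcases b with β | m'
  · rw [mmRead_inl_inl, mmRead_inl_inl, GcombSh_inr_inr]
  · rfl
  · rfl
  · rfl

/-- [folklore] The `mm`-read dictionary of the legged border through `G′_j` (twin of `ReflectionLocusSymShift.mmRead_Gsym_inl_inl_eq`, (Dff) a theorem):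
`mmRead Lc G′_j =ff= (wVH (j+1))⁻¹ · bhKStepSh d Lc (Dsh Lc) (j+1)`. -/
theorem mmRead_GcombSh_inl_inl_eq (j : ℕ) (x z : Fin (d + 1) → ℤ) (a b : Fin (d + 1)) :
    mmRead Lc (GcombSh (d := d) Lc j) x z (Sum.inl a) (Sum.inl b) = (wVH d Lc (j + 1))⁻¹ * bhKStepSh d Lc (Dsh Lc) (j + 1) x z (Sum.inl a) (Sum.inl b) := by
  rw [mmRead_GcombSh, bhKStepSh_apply]
  simp only [Pi.add_apply, Pi.smul_apply, smul_eq_mul, bhKStep_succ_inl_inl, Dsh_inl_inl, mul_zero, add_zero]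
  have hw : wVH d Lc (j + 1) ≠ 0 := by rw [wVH_eq_stepScale_sq]; exact pow_ne_zero _ (stepScale_ne_zero (j + 1))
  rw [← mul_assoc, inv_mul_cancel₀ hw, one_mul]

/-! ## §3 The products with the legged border and the four block facts -/

/-- [folklore] **`𝕄′_j ∘ G′_j = (𝕄′_j ∘ G_j) ∘ piK ρ_c`** (K1 right-blindness `comp_bhKStepSh_trK_piK` + tame associativity). -/
theorem comp_bhKStepSh_GcombSh (j : ℕ) :
    comp (bhKStepSh d Lc (Dsh Lc) j) (GcombSh (d := d) Lc j) = comp (comp (bhKStepSh d Lc (Dsh Lc) j) (Gsym Lc j)) (piK (ctr (d + 1) Lc) Lc) := by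
  have hL : 1 ≤ Lc := one_le_of_neZero Lc
  have hr := ctrOff_mem_box (d := d + 1) hL
  have hM : Tame (bhKStepSh d Lc (Dsh Lc) j) := (spr_bhKStepSh (spr_Dsh hL) j).tame
  have hP : Tame (piK (ctr (d + 1) Lc) Lc) := (spr_piK hL hr).tame
  have hPt : Tame (trK (piK (ctr (d + 1) Lc) Lc)) := (spr_trK_piK hL hr).tame
  have hG : Tame (Gsym (d := d) Lc j) := (spr_Gsym j).tame
  have hPG : Tame (comp (trK (piK (ctr (d + 1) Lc) Lc)) (Gsym (d := d) Lc j)) := (spr_comp (spr_trK_piK hL hr) (spr_Gsym j)).tame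
  rw [GcombSh_eq_comp, comp_assoc_tame hM hPG hP, comp_assoc_tame hM hPt hG, comp_bhKStepSh_trK_piK j]

/-- [folklore] **`G′_j ∘ 𝕄′_j = trK (piK ρ_c) ∘ (G_j ∘ 𝕄′_j)`** (K1 left-blindness `comp_piK_bhKStepSh` + tame associativity). -/
theorem comp_GcombSh_bhKStepSh (j : ℕ) :
    comp (GcombSh (d := d) Lc j) (bhKStepSh d Lc (Dsh Lc) j) = comp (trK (piK (ctr (d + 1) Lc) Lc)) (comp (Gsym Lc j) (bhKStepSh d Lc (Dsh Lc) j)) := by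
  have hL : 1 ≤ Lc := one_le_of_neZero Lc
  have hr := ctrOff_mem_box (d := d + 1) hL
  have hM : Tame (bhKStepSh d Lc (Dsh Lc) j) := (spr_bhKStepSh (spr_Dsh hL) j).tame
  have hP : Tame (piK (ctr (d + 1) Lc) Lc) := (spr_piK hL hr).tame
  have hPt : Tame (trK (piK (ctr (d + 1) Lc) Lc)) := (spr_trK_piK hL hr).tame
  have hG : Tame (Gsym (d := d) Lc j) := (spr_Gsym j).tame
  have hPG : Tame (comp (trK (piK (ctr (d + 1) Lc) Lc)) (Gsym (d := d) Lc j)) := (spr_comp (spr_trK_piK hL hr) (spr_Gsym j)).tame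
  rw [GcombSh_eq_comp, ← comp_assoc_tame hPG hP hM, comp_piK_bhKStepSh j, ← comp_assoc_tame hPt hG hM]

/-- [folklore] `(𝕄′_j ∘ G′_j)_fm = 0`. -/
theorem comp_bhKStepSh_GcombSh_inl_inr (j : ℕ) (x z : Fin (d + 1) → ℤ) (a m : Fin (d + 1)) :
    comp (bhKStepSh d Lc (Dsh Lc) j) (GcombSh (d := d) Lc j) x z (Sum.inl a) (Sum.inr m) = 0 := by
  rw [comp_bhKStepSh_GcombSh, comp_piK_inr, comp_bhKStepSh_Gsym_inl_inr (spr_Dsh (one_le_of_neZero Lc)) j (comp_Dsh_Gsym_inl_inr j)]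

/-- [folklore] `(G′_j ∘ 𝕄′_j)_mf = 0`. -/
theorem comp_GcombSh_bhKStepSh_inr_inl (j : ℕ) (x z : Fin (d + 1) → ℤ) (m a : Fin (d + 1)) :
    comp (GcombSh (d := d) Lc j) (bhKStepSh d Lc (Dsh Lc) j) x z (Sum.inr m) (Sum.inl a) = 0 := by
  rw [comp_GcombSh_bhKStepSh, trK_piK_comp_inr, comp_Gsym_bhKStepSh_inr_inl (spr_Dsh (one_le_of_neZero Lc)) j (comp_Gsym_Dsh_inr_inl j)]

/-- [folklore] `(𝕄′_j ∘ G′_j)_mm` is the identity between coarse multiplier legs. -/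
theorem comp_bhKStepSh_GcombSh_inr_inr (j : ℕ) (x z : Fin (d + 1) → ℤ) (m m' : Fin (d + 1)) (hx : Torus.proj Lc x = 0) :
    comp (bhKStepSh d Lc (Dsh Lc) j) (GcombSh (d := d) Lc j) x z (Sum.inr m) (Sum.inr m') = if x = z ∧ m = m' then 1 else 0 := by
  rw [comp_bhKStepSh_GcombSh, comp_piK_inr,
    comp_bhKStepSh_Gsym_inr_inr (spr_Dsh (one_le_of_neZero Lc)) (comp_comp_symEc_Dsh_symEc (one_le_of_neZero Lc)) j x z m m' hx]

/-- [folklore] `(G′_j ∘ 𝕄′_j)_mm` is the identity between coarse multiplier legs. -/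
theorem comp_GcombSh_bhKStepSh_inr_inr (j : ℕ) (x z : Fin (d + 1) → ℤ) (m m' : Fin (d + 1)) (hz : Torus.proj Lc z = 0) :
    comp (GcombSh (d := d) Lc j) (bhKStepSh d Lc (Dsh Lc) j) x z (Sum.inr m) (Sum.inr m') = if x = z ∧ m = m' then 1 else 0 := by
  rw [comp_GcombSh_bhKStepSh, trK_piK_comp_inr,
    comp_Gsym_bhKStepSh_inr_inr (spr_Dsh (one_le_of_neZero Lc)) (comp_comp_symEc_Dsh_symEc (one_le_of_neZero Lc)) j x z m m' hz]

/-! ## §4 The cubic-sector contact law through `G′_j` -/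

/-- [folklore] **THE CUBIC-SECTOR CONTACT LAW FOR THE CHART-(III′) RESOLVENTS AT EVERY LEVEL** (`Lc` odd): for a local stencil family `S` obeying the
(Sr-conj) law against `bhKStepSh d Lc (Dsh Lc) j` with contact `γ • diagK (ctGenM d (bhK Lc + Dsh Lc) α Lc κ u)`, `e3OfK Lc G′_j S` obeys the ff-law with contact
coefficient `γ∕(stepScale d Lc j · Lc^{d+1})` against `mmRead Lc G′_j` and the SAME generator — `E3ContactFactor.e3OfK_bref_inl_inl_of_lawM` at `(K, 𝕄, σ, B) :=
(G′_j, 𝕄′_j, stepScale d Lc j, bhK Lc + Dsh Lc)` with §2–§3's block facts and `refK_coDressKAt_Gsym`. -/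
theorem e3OfK_GcombSh_bref_inl_inl_of_law (hLc : Odd Lc) (j : ℕ)
    {α : Fin (d + 1)} {S : Fin (d + 1) → (Fin (d + 1) → ℤ) → MKer (d + 1) (Fib d)} {Cs δ : ℝ} (hS : LocStencil S Cs δ) (hδ : 0 < δ) (γ : ℝ)
    (hSr : ∀ κ u, S κ (bref α κ u) =
      reflSign α κ • refK (Φ (d := d) Lc α) (S κ u + conjV (bhKStepSh d Lc (Dsh Lc) j) (γ • diagK (ctGenM d (bhK Lc + Dsh Lc) α Lc κ u))))
    (κ' : Fin (d + 1)) (u' x z : Fin (d + 1) → ℤ) (a b : Fin (d + 1)) :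
    e3OfK Lc (GcombSh Lc j) S κ' (bref α κ' u') x z (Sum.inl a) (Sum.inl b) =
      reflSign α κ' * ((Φ (d := d) Lc α).s (Sum.inl a) * (Φ (d := d) Lc α).s (Sum.inl b) *
        (e3OfK Lc (GcombSh Lc j) S κ' u' ((Φ (d := d) Lc α).r (Sum.inl a) x) ((Φ (d := d) Lc α).r (Sum.inl b) z) (Sum.inl a) (Sum.inl b) +
          γ / (stepScale d Lc j * (Lc : ℝ) ^ (d + 1)) *
            conjV (mmRead Lc (GcombSh (d := d) Lc j)) (diagK (ctGenM d (bhK Lc + Dsh Lc) α Lc κ' u')) ((Φ (d := d) Lc α).r (Sum.inl a) x)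
              ((Φ (d := d) Lc α).r (Sum.inl b) z) (Sum.inl a) (Sum.inl b))) := by
  have hL : 1 ≤ Lc := one_le_of_neZero Lc
  have hKr : refK (Φ (d := d) Lc α) (GcombSh (d := d) Lc j) = GcombSh Lc j := by rw [GcombSh_apply]; exact refK_coDressKAt_Gsym hLc j α
  have hB : Spr (bhK (d := d) Lc + Dsh Lc) := spr_add (spr_bhK hL) (spr_Dsh hL)
  exact e3OfK_bref_inl_inl_of_lawM (spr_GcombSh j) hKr (spr_bhKStepSh (spr_Dsh hL) j) hB (stepScale d Lc j) (stepScale_ne_zero j)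
    (fun x z m b hx => GcombSh_inr_row_coarse j x z m b hx) (fun x z a m hz => GcombSh_inr_col_coarse j x z a m hz)
    (comp_bhKStepSh_GcombSh_inl_inr j) (comp_GcombSh_bhKStepSh_inr_inl j)
    (fun x z m m' hx _ => comp_bhKStepSh_GcombSh_inr_inr j x z m m' hx)
    (fun x z m m' _ hz => comp_GcombSh_bhKStepSh_inr_inr j x z m m' hz) (bhKStepSh_mf j)
    (bhKStepSh_mm (fun x y κ l => Dsh_inr_inr Lc x y κ l) j) hS hδ γ hSr κ' u' x z a b

/-- [folklore] **THE SAME WITH THE CONTACT AGAINST THE NEXT LEGGED BORDER `bhKStepSh d Lc (Dsh Lc) (j+1)`** (the `mm`-read dictionary `mmRead_GcombSh_inl_inl_eq`):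
coefficient `γ · (wVH (j+1))⁻¹ / (stepScale j · Lc^{d+1})` (twin of `ReflectionLocusSymShift.e3OfK_Gsym_bref_inl_inl_of_law'`). -/
theorem e3OfK_GcombSh_bref_inl_inl_of_law' (hLc : Odd Lc) (j : ℕ)
    {α : Fin (d + 1)} {S : Fin (d + 1) → (Fin (d + 1) → ℤ) → MKer (d + 1) (Fib d)} {Cs δ : ℝ} (hS : LocStencil S Cs δ) (hδ : 0 < δ) (γ : ℝ)
    (hSr : ∀ κ u, S κ (bref α κ u) =
      reflSign α κ • refK (Φ (d := d) Lc α) (S κ u + conjV (bhKStepSh d Lc (Dsh Lc) j) (γ • diagK (ctGenM d (bhK Lc + Dsh Lc) α Lc κ u))))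
    (κ' : Fin (d + 1)) (u' x z : Fin (d + 1) → ℤ) (a b : Fin (d + 1)) :
    e3OfK Lc (GcombSh Lc j) S κ' (bref α κ' u') x z (Sum.inl a) (Sum.inl b) =
      reflSign α κ' * ((Φ (d := d) Lc α).s (Sum.inl a) * (Φ (d := d) Lc α).s (Sum.inl b) *
        (e3OfK Lc (GcombSh Lc j) S κ' u' ((Φ (d := d) Lc α).r (Sum.inl a) x) ((Φ (d := d) Lc α).r (Sum.inl b) z) (Sum.inl a) (Sum.inl b) +
          γ * (wVH d Lc (j + 1))⁻¹ / (stepScale d Lc j * (Lc : ℝ) ^ (d + 1)) *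
            conjV (bhKStepSh d Lc (Dsh Lc) (j + 1)) (diagK (ctGenM d (bhK Lc + Dsh Lc) α Lc κ' u')) ((Φ (d := d) Lc α).r (Sum.inl a) x)
              ((Φ (d := d) Lc α).r (Sum.inl b) z) (Sum.inl a) (Sum.inl b))) := by
  rw [e3OfK_GcombSh_bref_inl_inl_of_law hLc j hS hδ γ hSr κ' u' x z a b,
    conjV_diagK_inl_inl_of_ff (wVH d Lc (j + 1))⁻¹ (mmRead_GcombSh_inl_inl_eq j)]
  ring

end Summit.QuantumFields.BalabanUV.Beta.CombChartContactFactor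

end
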